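import Summits.CriticalPhenomena.CardyFormulaZ2.Theorems.CardyUSTContinuationKirchhoffExtremalLengthG02Potential
import Literature.Probability.RandomPlanarGeometry.JordanDomainInterior

/-!
# A missing edge of `Ω_δ` at a vertex of `Ω_δ` meets `∂Ω` (G02 discretisation)

Support file for `KirchhoffExtremalLength` (route CardyUSTContinuation of `CardyFormulaZ2`, item
stmt-CriticalPhenomena-11234), towards `G02ModulusConvergence` (`…Defs.lean`). Two bookkeeping
facts about `Ω_δ = discreteDomainGraph Ω δ` used both by the weak-Beurling boundary estimate of
the potentials and by the no-winding lemma for walks of inner faces: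

* `mem_meshDomain_of_meshGraph_adj`: `meshDomain Ω δ` is a union of whole mesh components;
* `exists_mem_frontier_of_not_discreteDomainGraph_adj`: if `w ∈ Ω_δ` and the lattice edge to a
  neighbour `y` is not an edge of `Ω_δ`, the closed segment `[δw, δy]` meets `frontier Ω`.
-/

noncomputable section

namespace Summit.CriticalPhenomena.CardyFormulaZ2.Theorems

namespace KirchhoffSlope

open Set Metric Filter Topology
open Literature.Probability Literature.Probability.LatticeModels
open Literature.Probability.RandomPlanarGeometry

variable {Ω : Set ℂ} {δ : ℝ}

/-! ### A missing edge of `Ω_δ` at a vertex of `Ω_δ` meets the boundary -/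

/-- The discrete domain is a union of whole mesh components: a mesh vertex joined by a mesh edge
to a vertex of `meshDomain Ω δ` belongs to `meshDomain Ω δ`. [folklore] -/
theorem mem_meshDomain_of_meshGraph_adj {x y : Site 2} (hx : x ∈ meshDomain Ω δ)
    (hy : y ∈ meshVertices Ω δ) (hxy : (meshGraph Ω δ).Adj x y) : y ∈ meshDomain Ω δ := by
  simp only [meshDomain, mem_iUnion, mem_image] at hx ⊢
  obtain ⟨C, hC, x', hx'C, hx'x⟩ := hx
  refine ⟨C, hC, ⟨y, hy⟩, ?_, rfl⟩
  rw [SimpleGraph.ConnectedComponent.mem_supp_iff] at hx'C ⊢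
  rw [← hx'C]
  refine SimpleGraph.ConnectedComponent.sound (SimpleGraph.Adj.reachable ?_)
  change (meshGraph Ω δ).Adj y x'.1
  rw [hx'x]
  exact hxy.symm

/-- **A missing edge of `Ω_δ` at a vertex of `Ω_δ` meets `∂Ω`** (`Ω = D.carrier` a Jordan domain,
or any open set given with a boundary curve): if `w ∈ Ω_δ` and the lattice edge to its neighbour
`y` is not an edge of `Ω_δ`, the rescaled closed segment `[δw, δy]` meets `frontier Ω`. Either
the segment leaves `Ω̄` (then, being connected and starting in `Ω`, it crosses `∂Ω`), or `δy`
lies in `Ω̄ ∖ Ω` (a mesh vertex `y` joined to `w` inside `Ω̄` would belong to `Ω_δ`). [folklore] -/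
theorem exists_mem_frontier_of_not_discreteDomainGraph_adj (D : JordanDomain) {w y : Site 2}
    (hw : w ∈ meshDomain D.carrier δ) (hwy : (zdGraph 2).Adj w y)
    (hn : ¬ (discreteDomainGraph D.carrier δ).Adj w y) :
    ∃ f ∈ segment ℝ (meshPoint δ w) (meshPoint δ y), f ∈ frontier D.carrier := by
  have hwΩ : meshPoint δ w ∈ D.carrier := meshDomain_subset_meshVertices _ _ hw
  by_cases hseg : segment ℝ (meshPoint δ w) (meshPoint δ y) ⊆ closure D.carrier
  · have hadj : (meshGraph D.carrier δ).Adj w y := meshGraph_adj_iff.2 ⟨hwy, hseg⟩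
    have hy : y ∉ meshDomain D.carrier δ := fun hy => hn (discreteDomainGraph_adj_iff.2 ⟨hadj, hw, hy⟩)
    have hyΩ : meshPoint δ y ∉ D.carrier := fun hyΩ => hy (mem_meshDomain_of_meshGraph_adj hw hyΩ hadj)
    refine ⟨meshPoint δ y, right_mem_segment ℝ _ _, ?_⟩
    rw [D.isOpen.frontier_eq (s := D.carrier)]
    exact ⟨hseg (right_mem_segment ℝ _ _), hyΩ⟩
  · obtain ⟨f', hf', hf'c⟩ := not_subset.1 hseg
    obtain ⟨f, hf, hff⟩ := D.inter_frontier_nonempty_of_isPreconnected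
      (convex_segment (meshPoint δ w) (meshPoint δ y)).isPreconnected ⟨_, left_mem_segment ℝ _ _, hwΩ⟩
      ⟨f', hf', fun h => hf'c (subset_closure h)⟩
    exact ⟨f, hf, hff⟩

end KirchhoffSlope

end Summit.CriticalPhenomena.CardyFormulaZ2.Theorems
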